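import Summits.ResolutionOfSingularities.ResolutionOfSingularities.Theorems.FrobeniusLadderFInjectiveMacaulayficationPencilBlowupLocalChartsFull
import Literature.AlgebraicGeometry.Resolution.BlowupStalkBlowupAlgebra
import Literature.AlgebraicGeometry.Resolution.MarkedIdeals
import Literature.AlgebraicGeometry.Resolution.IdealSheafLemmas
import HarnessLib

/-!
# BED Ω, GLOBAL PATCH (g-b), F6 GLUE AT THE STALK: FULL stalks of a blowing up along a 2-generated centre from a regular pair IN THE LOCAL RING of the base point
# (`g14/F6-DESIGN.md` ADDENDUM: the 0BIQ charts at the stalk — no chart-global regular pair, hence no per-cone primality of `(θ_σ, χ_σ)` on the 1223 charts of the refined class model)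
# (crux `FInjectiveMacaulayfication` stmt-ResolutionOfSingularities-15315, chain w45a; seat res-L1-w45a-stub-3 g14)

[OURS · L1 W4.5a] Support file (`--supports stmt-ResolutionOfSingularities-15315 --as helper`); theorems only; GENERIC; no named fact; NOT a statement of any manuscript; nothing of the
crux is proved. AI-written (AI review is weaker than expert review).
* ★★ `fullCl_stalk_of_pair_stalk` — `π′ : Y′ → Y` a blowing up along `J`, `y′ ∈ Y′`, the stalk ideal `J_{π′y′} = (a, b)` with `(a, b)` and `(b, a)` regular pairs of the LOCAL ring
  `B = 𝒪_{Y, π′y′}`; if every localization of `B[X]/(aX − b)` and of `B[X]/(bX − a)` is `FullCl p` then `𝒪_{Y′,y′}` is `FullCl p` (Literature ✓ `IsBlowup.exists_blowupAlgebra_stalk_ringEquiv`: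
  `𝒪_{Y′,y′} ≅ B[(a,b)/c_j]_𝔔`; ✓ `ringEquiv_quotient_blowupAlgebra_pair`: `B[(a,b)/a] ≅ B[X]/(aX − b)` for a regular pair); `cmCl_stalk_of_pair_stalk` — the CM clause alone.
* ★ `fullCl_stalk_of_pair_germs` — affine form: `Y` affine, `J = (U, V)~` for global sections `U, V`, hypotheses on the germs of `U, V` at `π′ y′`.
[cite: StacksProject, Tag 0804, Tag 0BIQ; GortzWedhorn2020, (13.19)]
-/

set_option linter.dupNamespace false

noncomputable section

open AlgebraicGeometry CategoryTheory Literature.AlgebraicGeometry.Resolution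

namespace Summit.ResolutionOfSingularities.ResolutionOfSingularities.Theorems.FInjectiveMacaulayfication.PencilStalkPackage

open Summit.ResolutionOfSingularities.ResolutionOfSingularities.Theorems.FInjectiveMacaulayfication
open SliceableCentre PencilBlowupLocalCharts PencilBlowupLocalChartsFull

variable {Y Y' : Scheme.{0}} {π' : Y' ⟶ Y} {J : Y.IdealSheafData}

/-- Transport of «every localization is `FullCl p`» between blow-up algebras of (propositionally) equal ideals. [plumbing] -/
theorem fullCl_loc_blowupAlgebra_congr (p : ℕ) {B : Type} [CommRing B] {I I' : Ideal B} (h : I = I') (t : B)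
    (H : ∀ (Q : Ideal (blowupAlgebra I' t)) [Q.IsPrime], FullCl p (Localization.AtPrime Q)) :
    ∀ (Q : Ideal (blowupAlgebra I t)) [Q.IsPrime], FullCl p (Localization.AtPrime Q) := by
  subst h; exact H

/-- The same for the CM clause. [plumbing] -/
theorem cmCl_loc_blowupAlgebra_congr {B : Type} [CommRing B] {I I' : Ideal B} (h : I = I') (t : B)
    (H : ∀ (Q : Ideal (blowupAlgebra I' t)) [Q.IsPrime], CMCl (Localization.AtPrime Q)) :
    ∀ (Q : Ideal (blowupAlgebra I t)) [Q.IsPrime], CMCl (Localization.AtPrime Q) := by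
  subst h; exact H

/-- ★★ **FULL AT A POINT OF A BLOWING UP FROM A REGULAR PAIR IN THE LOCAL RING OF ITS IMAGE** (generators as a `Fin 2`-family `c`; `a = c 0`, `b = c 1`).
[OURS · F6 glue at the stalk; cite: StacksProject, Tag 0804 and Tag 0BIQ] -/
theorem fullCl_stalk_of_pair_stalk (p : ℕ) (hπ : IsBlowup π' J) (y' : Y') (c : Fin 2 → Y.presheaf.stalk (π'.base y'))
    (hJ : stalkIdeal J (π'.base y') = Ideal.span {c 0, c 1})
    (ha : c 0 ∈ nonZeroDivisors (Y.presheaf.stalk (π'.base y'))) (hab : ∀ r : Y.presheaf.stalk (π'.base y'), c 0 ∣ r * c 1 → c 0 ∣ r)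
    (hb : c 1 ∈ nonZeroDivisors (Y.presheaf.stalk (π'.base y'))) (hba : ∀ r : Y.presheaf.stalk (π'.base y'), c 1 ∣ r * c 0 → c 1 ∣ r)
    (hA : ∀ (Q : Ideal (Polynomial (Y.presheaf.stalk (π'.base y')) ⧸ Ideal.span {Polynomial.C (c 0) * Polynomial.X - Polynomial.C (c 1)})) [Q.IsPrime],
      FullCl p (Localization.AtPrime Q))
    (hB : ∀ (Q : Ideal (Polynomial (Y.presheaf.stalk (π'.base y')) ⧸ Ideal.span {Polynomial.C (c 1) * Polynomial.X - Polynomial.C (c 0)})) [Q.IsPrime],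
      FullCl p (Localization.AtPrime Q)) :
    FullCl p (Y'.presheaf.stalk y') := by
  have hI : Ideal.span {c 0, c 1} = Ideal.span (Set.range c) := by
    congr 1
    ext x
    simp only [Set.mem_insert_iff, Set.mem_singleton_iff, Set.mem_range]
    constructor
    · rintro (rfl | rfl)
      · exact ⟨0, rfl⟩
      · exact ⟨1, rfl⟩
    · rintro ⟨i, rfl⟩
      rcases i with ⟨_ | _ | i, hi⟩
      · exact Or.inl rfl
      · exact Or.inr rfl
      · omega
  obtain ⟨j, 𝔔, χ, e, -, -, -, -⟩ := hπ.exists_blowupAlgebra_stalk_ringEquiv_of_eq y' c (Ideal.span {c 0, c 1}) hI hJ.symm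
  have hj : j = 0 ∨ j = 1 := by
    rcases j with ⟨_ | _ | j, hj⟩
    · exact Or.inl rfl
    · exact Or.inr rfl
    · omega
  have key : FullCl p (Localization.AtPrime 𝔔.asIdeal) := by
    rcases hj with rfl | rfl
    · obtain ⟨θ, -, -⟩ := ringEquiv_quotient_blowupAlgebra_pair (c 0) (c 1) ha hab
      exact fullCl_localization_of_ringEquiv' p θ.symm hA 𝔔.asIdeal
    · obtain ⟨θ, -, -⟩ := ringEquiv_quotient_blowupAlgebra_pair (c 1) (c 0) hb hba
      have hsw : Ideal.span {c 0, c 1} = Ideal.span {c 1, c 0} := by rw [Set.pair_comm]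
      exact fullCl_loc_blowupAlgebra_congr p hsw (c 1) (fullCl_localization_of_ringEquiv' p θ.symm hB) 𝔔.asIdeal
  exact fullCl_of_ringEquiv' p e.symm key

/-- The CM clause alone, same shape. [OURS · F6 glue at the stalk] -/
theorem cmCl_stalk_of_pair_stalk (hπ : IsBlowup π' J) (y' : Y') (c : Fin 2 → Y.presheaf.stalk (π'.base y'))
    (hJ : stalkIdeal J (π'.base y') = Ideal.span {c 0, c 1})
    (ha : c 0 ∈ nonZeroDivisors (Y.presheaf.stalk (π'.base y'))) (hab : ∀ r : Y.presheaf.stalk (π'.base y'), c 0 ∣ r * c 1 → c 0 ∣ r)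
    (hb : c 1 ∈ nonZeroDivisors (Y.presheaf.stalk (π'.base y'))) (hba : ∀ r : Y.presheaf.stalk (π'.base y'), c 1 ∣ r * c 0 → c 1 ∣ r)
    (hA : ∀ (Q : Ideal (Polynomial (Y.presheaf.stalk (π'.base y')) ⧸ Ideal.span {Polynomial.C (c 0) * Polynomial.X - Polynomial.C (c 1)})) [Q.IsPrime],
      CMCl (Localization.AtPrime Q))
    (hB : ∀ (Q : Ideal (Polynomial (Y.presheaf.stalk (π'.base y')) ⧸ Ideal.span {Polynomial.C (c 1) * Polynomial.X - Polynomial.C (c 0)})) [Q.IsPrime],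
      CMCl (Localization.AtPrime Q)) :
    CMCl (Y'.presheaf.stalk y') := by
  have hI : Ideal.span {c 0, c 1} = Ideal.span (Set.range c) := by
    congr 1
    ext x
    simp only [Set.mem_insert_iff, Set.mem_singleton_iff, Set.mem_range]
    constructor
    · rintro (rfl | rfl)
      · exact ⟨0, rfl⟩
      · exact ⟨1, rfl⟩
    · rintro ⟨i, rfl⟩
      rcases i with ⟨_ | _ | i, hi⟩
      · exact Or.inl rfl
      · exact Or.inr rfl
      · omega
  obtain ⟨j, 𝔔, χ, e, -, -, -, -⟩ := hπ.exists_blowupAlgebra_stalk_ringEquiv_of_eq y' c (Ideal.span {c 0, c 1}) hI hJ.symm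
  have hj : j = 0 ∨ j = 1 := by
    rcases j with ⟨_ | _ | j, hj⟩
    · exact Or.inl rfl
    · exact Or.inr rfl
    · omega
  have key : CMCl (Localization.AtPrime 𝔔.asIdeal) := by
    rcases hj with rfl | rfl
    · obtain ⟨θ, -, -⟩ := ringEquiv_quotient_blowupAlgebra_pair (c 0) (c 1) ha hab
      exact cmCl_localization_of_ringEquiv θ.symm hA 𝔔.asIdeal
    · obtain ⟨θ, -, -⟩ := ringEquiv_quotient_blowupAlgebra_pair (c 1) (c 0) hb hba
      have hsw : Ideal.span {c 0, c 1} = Ideal.span {c 1, c 0} := by rw [Set.pair_comm]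
      exact cmCl_loc_blowupAlgebra_congr hsw (c 1) (cmCl_localization_of_ringEquiv θ.symm hB) 𝔔.asIdeal
  exact FiLocusOpenOfAffine.cmClause_of_ringEquiv e.symm key

/-- ★ **AFFINE FORM.** `Y` affine, `π′` a blowing up along `(U, V)~` for global sections `U, V`; hypotheses on the germs `U_y, V_y` at `y = π′ y′`. [OURS · F6 glue at the stalk] -/
theorem fullCl_stalk_of_pair_germs (p : ℕ) [IsAffine Y] (U V : Γ(Y, ⊤)) (hπ : IsBlowup π' (Scheme.IdealSheafData.ofIdealTop (Ideal.span {U, V}))) (y' : Y')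
    (ha : (Y.presheaf.germ ⊤ (π'.base y') trivial).hom U ∈ nonZeroDivisors (Y.presheaf.stalk (π'.base y')))
    (hab : ∀ r : Y.presheaf.stalk (π'.base y'), (Y.presheaf.germ ⊤ (π'.base y') trivial).hom U ∣ r * (Y.presheaf.germ ⊤ (π'.base y') trivial).hom V →
      (Y.presheaf.germ ⊤ (π'.base y') trivial).hom U ∣ r)
    (hb : (Y.presheaf.germ ⊤ (π'.base y') trivial).hom V ∈ nonZeroDivisors (Y.presheaf.stalk (π'.base y')))
    (hba : ∀ r : Y.presheaf.stalk (π'.base y'), (Y.presheaf.germ ⊤ (π'.base y') trivial).hom V ∣ r * (Y.presheaf.germ ⊤ (π'.base y') trivial).hom U →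
      (Y.presheaf.germ ⊤ (π'.base y') trivial).hom V ∣ r)
    (hA : ∀ (Q : Ideal (Polynomial (Y.presheaf.stalk (π'.base y')) ⧸ Ideal.span {Polynomial.C ((Y.presheaf.germ ⊤ (π'.base y') trivial).hom U) * Polynomial.X -
      Polynomial.C ((Y.presheaf.germ ⊤ (π'.base y') trivial).hom V)})) [Q.IsPrime], FullCl p (Localization.AtPrime Q))
    (hB : ∀ (Q : Ideal (Polynomial (Y.presheaf.stalk (π'.base y')) ⧸ Ideal.span {Polynomial.C ((Y.presheaf.germ ⊤ (π'.base y') trivial).hom V) * Polynomial.X -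
      Polynomial.C ((Y.presheaf.germ ⊤ (π'.base y') trivial).hom U)})) [Q.IsPrime], FullCl p (Localization.AtPrime Q)) :
    FullCl p (Y'.presheaf.stalk y') := by
  refine fullCl_stalk_of_pair_stalk p hπ y' ![(Y.presheaf.germ ⊤ (π'.base y') trivial).hom U, (Y.presheaf.germ ⊤ (π'.base y') trivial).hom V] ?_ ha hab hb hba hA hB
  rw [stalkIdeal_eq_map_germ _ ⟨⊤, isAffineOpen_top Y⟩ trivial, ideal_ofIdealTop_top, Ideal.map_span, Set.image_pair]
  rfl


/-- ★ **TRANSPORT FORM.** As `fullCl_stalk_of_pair_stalk`, with the generators given as `Φ a₀, Φ b₀` for a ring isomorphism `Φ : B₀ ≃+* 𝒪_{Y, π′y′}` and all hypotheses stated in `B₀`.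
[OURS · F6 glue at the stalk] -/
theorem fullCl_stalk_of_pair_transport (p : ℕ) (hπ : IsBlowup π' J) (y' : Y') {B₀ : Type} [CommRing B₀] (Φ : B₀ ≃+* Y.presheaf.stalk (π'.base y')) (a₀ b₀ : B₀)
    (hJ : stalkIdeal J (π'.base y') = Ideal.span {Φ a₀, Φ b₀})
    (ha : a₀ ∈ nonZeroDivisors B₀) (hab : ∀ r : B₀, a₀ ∣ r * b₀ → a₀ ∣ r) (hb : b₀ ∈ nonZeroDivisors B₀) (hba : ∀ r : B₀, b₀ ∣ r * a₀ → b₀ ∣ r)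
    (hA : ∀ (Q : Ideal (Polynomial B₀ ⧸ Ideal.span {Polynomial.C a₀ * Polynomial.X - Polynomial.C b₀})) [Q.IsPrime], FullCl p (Localization.AtPrime Q))
    (hB : ∀ (Q : Ideal (Polynomial B₀ ⧸ Ideal.span {Polynomial.C b₀ * Polynomial.X - Polynomial.C a₀})) [Q.IsPrime], FullCl p (Localization.AtPrime Q)) :
    FullCl p (Y'.presheaf.stalk y') := by
  obtain ⟨ha', hab'⟩ := regularPair_of_ringEquiv Φ ha hab
  obtain ⟨hb', hba'⟩ := regularPair_of_ringEquiv Φ hb hba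
  obtain ⟨ψ, -, -⟩ := exists_pencilQuot_ringEquiv_of_ringEquiv Φ a₀ b₀
  obtain ⟨ψ', -, -⟩ := exists_pencilQuot_ringEquiv_of_ringEquiv Φ b₀ a₀
  have hA' := fullCl_localization_of_ringEquiv' p ψ.symm hA
  have hB' := fullCl_localization_of_ringEquiv' p ψ'.symm hB
  exact fullCl_stalk_of_pair_stalk p hπ y' ![Φ a₀, Φ b₀] hJ ha' hab' hb' hba' hA' hB'

/-! ## Over an affine open of the base: hypotheses on the germs in `𝒪_{X̃, τ s}` -/

section Restrict

variable {Xt S' : Scheme.{0}} {τ : S' ⟶ Xt} {𝒥 : Xt.IdealSheafData}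

/-- Germ transport across the restriction to an affine open: the germ of `e u ∈ Γ(W, ⊤)` at `(τ|_W) s'` is the germ of `u` at `τ s`, along `stalkIso` and `stalkCongr`. [plumbing] -/
theorem exists_ringEquiv_stalk_restrict (W : Xt.affineOpens) (e : Γ(Xt, W) ≃+* Γ((W : Xt.Opens), ⊤))
    (he : ∀ x, e x = ((W : Xt.Opens).ι.appLE W ⊤ (W : Xt.Opens).ι_preimage_self.ge).hom x) (s : S') (hs : τ.base s ∈ (W : Xt.Opens)) :
    ∃ Φ : Xt.presheaf.stalk (τ.base s) ≃+* (W : Xt.Opens).toScheme.presheaf.stalk ((τ ∣_ (W : Xt.Opens)).base ⟨s, hs⟩),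
      ∀ x : Γ(Xt, W), Φ ((Xt.presheaf.germ W (τ.base s) hs).hom x) =
        (((W : Xt.Opens).toScheme.presheaf.germ ⊤ ((τ ∣_ (W : Xt.Opens)).base ⟨s, hs⟩) trivial).hom (e x)) := by
  have hx : ((τ ∣_ (W : Xt.Opens)).base ⟨s, hs⟩).1 = τ.base s := morphismRestrict_base_coe τ (W : Xt.Opens) ⟨s, hs⟩
  have hins : Inseparable ((τ ∣_ (W : Xt.Opens)).base ⟨s, hs⟩).1 (τ.base s) := by rw [hx]
  have hmem : τ.base s ∈ (W : Xt.Opens).ι ''ᵁ ⊤ := by rw [Scheme.Opens.ι_image_top]; exact hs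
  let ι : (W : Xt.Opens).toScheme.presheaf.stalk ((τ ∣_ (W : Xt.Opens)).base ⟨s, hs⟩) ≅ Xt.presheaf.stalk (τ.base s) :=
    (W : Xt.Opens).stalkIso ((τ ∣_ (W : Xt.Opens)).base ⟨s, hs⟩) ≪≫ Xt.presheaf.stalkCongr hins
  have h1 : (W : Xt.Opens).toScheme.presheaf.germ ⊤ ((τ ∣_ (W : Xt.Opens)).base ⟨s, hs⟩) trivial ≫ ι.hom = Xt.presheaf.germ ((W : Xt.Opens).ι ''ᵁ ⊤) (τ.base s) hmem := by
    change (W : Xt.Opens).toScheme.presheaf.germ ⊤ ((τ ∣_ (W : Xt.Opens)).base ⟨s, hs⟩) trivial ≫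
      ((W : Xt.Opens).stalkIso ((τ ∣_ (W : Xt.Opens)).base ⟨s, hs⟩)).hom ≫ Xt.presheaf.stalkSpecializes hins.ge = _
    rw [Scheme.Opens.germ_stalkIso_hom_assoc]
    exact TopCat.Presheaf.germ_stalkSpecializes Xt.presheaf _ hins.ge
  refine ⟨ι.commRingCatIsoToRingEquiv.symm, fun x => ?_⟩
  rw [RingEquiv.symm_apply_eq]
  change _ = (((W : Xt.Opens).toScheme.presheaf.germ ⊤ ((τ ∣_ (W : Xt.Opens)).base ⟨s, hs⟩) trivial) ≫ ι.hom).hom (e x)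
  rw [h1, he, Scheme.Opens.ι_appLE]
  exact (TopCat.Presheaf.germ_res_apply Xt.presheaf _ _ _ x).symm

/-- ★★ **FULL STALKS OVER A `γ·(u, v)`-OPEN FROM A REGULAR PAIR OF GERMS.** Setting of ✓ `PencilBlowupLocalChartsFull.fullCl_stalk_of_pair` (`𝒥(W) = (γu, γv)`, `γ` regular), but the
regular-pair and FULL hypotheses are imposed only on the GERMS `u_x, v_x ∈ 𝒪_{X̃, x}`, `x = τ s` (no chart-global regular pair). [OURS · F6 glue at the stalk; cite: StacksProject, Tag 0804,
Tag 0BIQ, Tag 080A] -/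
theorem fullCl_stalk_of_pair_germ (p : ℕ) (hτ : IsBlowup τ 𝒥) (W : Xt.affineOpens) (γ u v : Γ(Xt, W)) (h𝒥 : 𝒥.ideal W = Ideal.span {γ * u, γ * v})
    (hγ : γ ∈ nonZeroDivisors Γ(Xt, W)) (s : S') (hs : τ.base s ∈ (W : Xt.Opens))
    (hu : (Xt.presheaf.germ W (τ.base s) hs).hom u ∈ nonZeroDivisors (Xt.presheaf.stalk (τ.base s)))
    (huv : ∀ r : Xt.presheaf.stalk (τ.base s), (Xt.presheaf.germ W (τ.base s) hs).hom u ∣ r * (Xt.presheaf.germ W (τ.base s) hs).hom v →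
      (Xt.presheaf.germ W (τ.base s) hs).hom u ∣ r)
    (hv : (Xt.presheaf.germ W (τ.base s) hs).hom v ∈ nonZeroDivisors (Xt.presheaf.stalk (τ.base s)))
    (hvu : ∀ r : Xt.presheaf.stalk (τ.base s), (Xt.presheaf.germ W (τ.base s) hs).hom v ∣ r * (Xt.presheaf.germ W (τ.base s) hs).hom u →
      (Xt.presheaf.germ W (τ.base s) hs).hom v ∣ r)
    (hW : ∀ (Q : Ideal (Polynomial (Xt.presheaf.stalk (τ.base s)) ⧸ Ideal.span {Polynomial.C ((Xt.presheaf.germ W (τ.base s) hs).hom u) * Polynomial.X -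
      Polynomial.C ((Xt.presheaf.germ W (τ.base s) hs).hom v)})) [Q.IsPrime], FullCl p (Localization.AtPrime Q))
    (hU : ∀ (Q : Ideal (Polynomial (Xt.presheaf.stalk (τ.base s)) ⧸ Ideal.span {Polynomial.C ((Xt.presheaf.germ W (τ.base s) hs).hom v) * Polynomial.X -
      Polynomial.C ((Xt.presheaf.germ W (τ.base s) hs).hom u)})) [Q.IsPrime], FullCl p (Localization.AtPrime Q)) :
    FullCl p (S'.presheaf.stalk s) := by
  haveI : IsAffine (W : Xt.Opens) := W.2
  obtain ⟨e, he⟩ := exists_resTop W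
  have hB := isBlowup_restrict_pair hτ W γ u v h𝒥 hγ e he
  obtain ⟨Φ, hΦ⟩ := exists_ringEquiv_stalk_restrict W e he s hs
  have hJ : stalkIdeal (Scheme.IdealSheafData.ofIdealTop (Ideal.span {e u, e v}) : (W : Xt.Opens).toScheme.IdealSheafData) ((τ ∣_ (W : Xt.Opens)).base ⟨s, hs⟩) =
      Ideal.span {Φ ((Xt.presheaf.germ W (τ.base s) hs).hom u), Φ ((Xt.presheaf.germ W (τ.base s) hs).hom v)} := by
    rw [stalkIdeal_eq_map_germ _ ⟨⊤, isAffineOpen_top _⟩ trivial, ideal_ofIdealTop_top, Ideal.map_span, Set.image_pair, hΦ, hΦ]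
  have key : FullCl p ((τ ⁻¹ᵁ (W : Xt.Opens)).toScheme.presheaf.stalk (⟨s, hs⟩ : ↥(τ ⁻¹ᵁ (W : Xt.Opens)))) :=
    fullCl_stalk_of_pair_transport p hB ⟨s, hs⟩ Φ _ _ hJ hu huv hv hvu hW hU
  exact fullCl_of_ringEquiv' p ((τ ⁻¹ᵁ (W : Xt.Opens)).stalkIso ⟨s, hs⟩).commRingCatIsoToRingEquiv key

end Restrict

end Summit.ResolutionOfSingularities.ResolutionOfSingularities.Theorems.FInjectiveMacaulayfication.PencilStalkPackage

end
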